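import Summits.CriticalPhenomena.PercolationContinuityZ3.Theorems.PercNearOneGluingNoHeavyLowerTailStarSetForestChampion
import HarnessLib

/-!
# `NoHeavyLowerTail` (stmt-CriticalPhenomena-4575) — the forest theorem for a FINSET of two-port stars (vertex order as peeling order)

Support file (prover `prim-gen-swap` gen 7; `--supports stmt-CriticalPhenomena-4575`).  No definitions, no named facts, no sorries.

* `StarSet.setCS_twoPortStarForestSet_levelTwo_champion` — finset form of `StarSet.setCS_twoPortStarForest_levelTwo_champion`: `B` a finset of
  two-port pendant stars (`y ∉ A`, ports `p y ≠ p' y ∈ A`, no other positive pair) such that, in the natural order of the vertex labels, the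
  second port of an earlier star is never a port of a later one (`y < y' → p' y ∉ {p y', p' y'}` — a leaf-peeling order of a forest port graph,
  realised by relabelling), `c` a champion of `A`, `j ≤ 2`.  Then `CS_w(B, c)`: `μ(c ↮ B, 1 ≤ |π(B)| ≤ j) ≤ μ(c ↮ B, |π(c)| ≤ j)`.
  (Distinct ports: `StarSet.setCS_twoPortStarSet_levelTwo_champion`, no order needed.)
-/

noncomputable section

namespace Summit.CriticalPhenomena.PercolationContinuityZ3.Theorems

open MeasureTheory Set Literature.Probability.LatticeModels Literature.Probability.Percolation
open scoped Classical BigOperators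

variable {n : ℕ}

namespace StarSet

/-- **OES at level `j ≤ 2` for a finset of two-port pendant stars whose port graph is a forest, peeled in the order of the vertex labels;
champion witness.** [cite: VandenbergHaggstromKahn2005, Thm. 1.5 (p. 7) — via `StarSet.setCS_twoPortStarForest_levelTwo_champion`] -/
theorem setCS_twoPortStarForestSet_levelTwo_champion (w : Sym2 (Fin n) → unitInterval) (A B : Finset (Fin n)) (p p' : Fin n → Fin n)
    (c : Fin n) (j : ℕ) (hj : j ≤ 2) (hBA : ∀ y ∈ B, y ∉ A)
    (hports : ∀ y ∈ B, p y ∈ A ∧ p' y ∈ A ∧ p y ≠ p' y)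
    (hobs : ∀ y ∈ B, ∀ u : Fin n, u ≠ y → w s(y, u) ≠ 0 → u = p y ∨ u = p' y)
    (hforest : ∀ y ∈ B, ∀ y' ∈ B, y < y' → p' y ≠ p y' ∧ p' y ≠ p' y')
    (hcA : c ∈ A)
    (hchamp : ∀ a ∈ A, (prodBernoulli w).real {ω : BondConfig (Fin n) | (A.filter fun z => ω ∈ openConn a z).card ≤ j} ≤
      (prodBernoulli w).real {ω : BondConfig (Fin n) | (A.filter fun z => ω ∈ openConn c z).card ≤ j}) :
    (prodBernoulli w).real {ω : BondConfig (Fin n) | (∀ y ∈ B, ω ∉ openConn c y) ∧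
        1 ≤ (A.filter fun z => ∃ y ∈ B, ω ∈ openConn y z).card ∧
        (A.filter fun z => ∃ y ∈ B, ω ∈ openConn y z).card ≤ j} ≤
      (prodBernoulli w).real {ω : BondConfig (Fin n) | (∀ y ∈ B, ω ∉ openConn c y) ∧
        (A.filter fun z => ω ∈ openConn c z).card ≤ j} := by
  -- enumerate the stars increasingly
  set emb := B.orderEmbOfFin rfl with hemb
  set s : Fin B.card → Fin n := fun k => emb k with hs_def
  have hsB : ∀ k, s k ∈ B := fun k => Finset.orderEmbOfFin_mem B rfl k
  have hs : Function.Injective s := fun k k' h => emb.injective h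
  have hSB : Finset.univ.image s = B := by
    ext x
    rw [Finset.mem_image]
    constructor
    · rintro ⟨k, -, rfl⟩; exact hsB k
    · intro hx
      have hrange := Finset.range_orderEmbOfFin B rfl
      have hx' : x ∈ Set.range emb := by rw [hemb, hrange]; exact hx
      obtain ⟨k, hk⟩ := hx'
      exact ⟨k, Finset.mem_univ _, by simp only [hs_def, hk]⟩
  have h := setCS_twoPortStarForest_levelTwo_champion A c j hj hcA B.card w s (fun k => p (s k)) (fun k => p' (s k)) hs
    (fun k => hBA _ (hsB k)) (fun k => (hports _ (hsB k)).1) (fun k => (hports _ (hsB k)).2.1) (fun k => (hports _ (hsB k)).2.2)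
    (fun k k' hkk' => hforest _ (hsB k) _ (hsB k') (emb.strictMono hkk'))
    (fun k u hu hup hup' => by
      by_contra hne
      rcases hobs _ (hsB k) u hu hne with h | h
      · exact hup h
      · exact hup' h)
    hchamp
  rw [hSB] at h
  exact h

end StarSet

end Summit.CriticalPhenomena.PercolationContinuityZ3.Theorems

end
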